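import Literature.LinearAlgebra.Matrix.ModularDiagonalSolver
import Literature.Computability.Complexity.ModularEuclidFP
import HarnessLib

/-!
# The rounds of the modular diagonalisation in polynomial time on codes

Topic `Literature/Computability/Complexity`; the machine side of the row phase, the column phase
and the rounds of `Literature/LinearAlgebra/Matrix/ModularDiagonalSolver.lean` (sequel of
`ModularEuclidFP.lean`).  Fuel is always handed over as the LENGTH OF A BUDGET LIST of units:

* **`rowPhase_codeFP`**: `((N, budget), M) ↦ rowPhase N |budget| M` (a left fold of `euclid` over
  the other rows, accumulator = current top row and the processed rows);
* **`colFold_codeFP`**, **`colPhase_codeFP`**: the column phase `colPhase N F c M` treats the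
  columns `1, …, c-1`; since every column index beyond the top row is a no-op
  (`colPhase_eq_colFold_min`), it is computed over `1, …, min (c, |top|) - 1`, a list of
  polynomial length even when the numeral `c` is not;
* **`round_codeFP`**, **`rounds_codeFP`**.

All accumulators stay SMALL (`ModDiagFP.MatSmall`: no more rows, no longer rows, every entry an
input entry or a residue `≤ N`), which is the polynomial bound `CodeFP.foldl` asks for.

## References

* S. Arora, B. Barak, *Computational Complexity: A Modern Approach*, CUP 2009, §1.3
  [AroraBarak2009].
* A. Schrijver, *Theory of Linear and Integer Programming*, Wiley 1986, §5.3 [Schrijver1986].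
-/

namespace Literature.Computability.Complexity

namespace ModDiagFP

open CodeFP Polynomial _root_.Computability Literature.LinearAlgebra.Matrix
  Literature.LinearAlgebra.Matrix.ModDiag

/-- Rows of naturals: raw lists of binary numerals. -/
local notation "rowE" => rawE natE

/-- Row lists. -/
local notation "matE" => rawE (rawE natE)

/-- Budgets: raw lists of units. -/
local notation "budE" => rawE unitE

/-! ### The row phase -/

/-- The row phase fold keeps everything small. [folklore] -/
theorem rowFold_small {W N : ℕ} (hN : (natE N).length ≤ W) (F : ℕ) :
    ∀ (rest : List (List ℕ)) (t : List ℕ) (acc : List (List ℕ)), RowSmall W t → (∀ r ∈ rest, RowSmall W r) →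
      RowSmall W (rest.foldl (rowStep N F) (t, acc)).1 ∧
        ∃ new, (rest.foldl (rowStep N F) (t, acc)).2 = acc ++ new ∧ new.length = rest.length ∧
          ∀ r ∈ new, RowSmall W r := by
  intro rest
  induction rest with
  | nil => intro t acc ht _; exact ⟨ht, [], by simp, rfl, by simp⟩
  | cons v rest ih =>
    intro t acc ht hr
    rw [List.foldl_cons]
    obtain ⟨h1, h2⟩ := rowSmall_euclid hN F (k := (t, v)) ht (hr v List.mem_cons_self)
    have hstep : rowStep N F (t, acc) v = ((euclid N F (t, v)).1, acc ++ [(euclid N F (t, v)).2]) := rfl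
    rw [hstep]
    obtain ⟨h3, new, h4, h5, h6⟩ := ih _ (acc ++ [(euclid N F (t, v)).2]) h1 (fun r hr' => hr r (List.mem_cons_of_mem v hr'))
    refine ⟨h3, (euclid N F (t, v)).2 :: new, by simp [h4], by simp [h5], fun r hr' => ?_⟩
    rcases List.mem_cons.1 hr' with rfl | hr'
    · exact h2
    · exact h6 r hr'

/-- The row phase keeps a small row list small. [folklore] -/
theorem matSmall_rowPhase {W N : ℕ} (hN : (natE N).length ≤ W) (F : ℕ) {M : List (List ℕ)} (h : MatSmall W M) :
    MatSmall W (rowPhase N F M) := by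
  cases M with
  | nil => exact h
  | cons t rest =>
    obtain ⟨h1, new, h2, h3, h4⟩ := rowFold_small hN F rest t [] (h.2 t List.mem_cons_self)
      (fun r hr => h.2 r (List.mem_cons_of_mem t hr))
    rw [List.nil_append] at h2
    rw [rowPhase, h2]
    refine ⟨by simpa [h3] using h.1, fun r hr => ?_⟩
    rcases List.mem_cons.1 hr with rfl | hr
    · exact h1
    · exact h4 r hr

/-- **The row phase on codes**: `((N, budget), M) ↦ rowPhase N |budget| M`. [cite: AroraBarak2009, §1.3] -/
theorem rowPhase_codeFP : CodeFP (pairE (pairE natE budE) matE) matE (fun t => rowPhase t.1.1 t.1.2.length t.2) := by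
  -- the fold over the other rows, context `((N, budget), t)`, accumulator `(top, processed)`
  let cE := pairE (pairE natE budE) rowE
  let tE := pairE cE (pairE rowE (pairE rowE matE))
  have pN : CodeFP tE natE (fun t => t.1.1.1) := (fst _ _).fst'.fst'
  have pB : CodeFP tE budE (fun t => t.1.1.2) := (fst _ _).fst'.snd'
  have pv : CodeFP tE rowE (fun t => t.2.1) := (snd _ _).fst'
  have ptop : CodeFP tE rowE (fun t => t.2.2.1) := (snd _ _).snd'.fst'
  have pacc : CodeFP tE matE (fun t => t.2.2.2) := (snd _ _).snd'.snd'
  have he : CodeFP tE (pairE rowE rowE) (fun t => euclid t.1.1.1 t.1.1.2.length (t.2.2.1, t.2.1)) :=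
    euclid_codeFP.comp ((pN.pair (ptop.pair pv)).pair pB)
  have hstep : CodeFP tE (pairE rowE matE)
      (fun t => rowStep t.1.1.1 t.1.1.2.length t.2.2 t.2.1) :=
    (he.fst'.pair ((rawAppend (rawE natE)).comp (pacc.pair ((rawSingleton (rawE natE)).comp he.snd')))).congr fun _ => rfl
  have hinit : CodeFP cE (pairE rowE matE) (fun s => (s.2, ([] : List (List ℕ)))) := (snd _ _).pair (const _ [])
  have hfold := foldl (σ := (ℕ × List Unit) × List ℕ) (α := List ℕ) (β := List ℕ × List (List ℕ))
    (eσ := cE) (eα := rowE) (eβ := pairE rowE matE)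
    (step := fun s v acc => rowStep s.1.1 s.1.2.length acc v) (init := fun s => (s.2, [])) hstep hinit
    (2 * (X * (2 * X + 2)) + 2 + X * (2 * (X * (2 * X + 2)) + 2)) (fun s l₁ l₂ => by
      obtain ⟨⟨N, bud⟩, t⟩ := s
      set W := (pairE cE matE (((N, bud), t), l₁ ++ l₂)).length with hW
      have hWN : (natE N).length ≤ W := by simp only [hW, cE, pairE_apply, length_boolPair]; omega
      have ht : (rawE natE t).length ≤ W := by simp only [hW, cE, pairE_apply, length_boolPair]; omega
      have hl : (rawE (rawE natE) (l₁ ++ l₂)).length ≤ W := by simp only [hW, cE, pairE_apply, length_boolPair]; omega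
      have hsm := matSmall_of_length_le hl
      obtain ⟨h1, new, h2, h3, h4⟩ := rowFold_small hWN bud.length l₁ t [] (rowSmall_of_length_le ht)
        (fun r hr => hsm.2 r (List.mem_append_left l₂ hr))
      change (pairE rowE matE (l₁.foldl (rowStep N bud.length) (t, []))).length ≤ _
      rw [List.nil_append] at h2
      have hnew : MatSmall W new := ⟨h3 ▸ (by have := hsm.1; rw [List.length_append] at this; omega), h4⟩
      have b1 := length_rawE_le_of_rowSmall h1
      have b2 := length_rawE_le_of_matSmall hnew
      rw [pairE_apply, length_boolPair, h2]
      simp only [eval_add, eval_mul, eval_ofNat, eval_X]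
      omega)
  -- case analysis on `M`
  have hcons : CodeFP (pairE (pairE natE budE) (pairE rowE matE)) matE
      (fun t => (t.2.2.foldl (rowStep t.1.1 t.1.2.length) (t.2.1, [])).1 ::
        (t.2.2.foldl (rowStep t.1.1 t.1.2.length) (t.2.1, [])).2) := by
    have hf : CodeFP (pairE (pairE natE budE) (pairE rowE matE)) (pairE rowE matE)
        (fun t => t.2.2.foldl (rowStep t.1.1 t.1.2.length) (t.2.1, [])) :=
      (hfold.comp (((fst _ _).pair (snd _ _).fst').pair (snd _ _).snd')).congr fun _ => rfl
    exact ((rawCons (rawE natE)).comp (hf.fst'.pair hf.snd')).congr fun _ => rfl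
  exact rawCases (k := fun (s : ℕ × List Unit) (M : List (List ℕ)) => rowPhase s.1 s.2.length M)
    (const _ []) hcons (fun _ => rfl) (fun _ _ _ => rfl)

/-! ### The column phase -/

/-- The column fold keeps a small row list small. [folklore] -/
theorem matSmall_colFold {W N : ℕ} (hN : (natE N).length ≤ W) (F : ℕ) (js : List ℕ) {M : List (List ℕ)}
    (h : MatSmall W M) : MatSmall W (colFold N F js M) := by
  induction js generalizing M with
  | nil => exact h
  | cons j js ih => rw [colFold, List.foldl_cons, ← colFold]; exact ih (matSmall_ceuclid hN F h)

/-- **The column fold on codes**: `((N, budget), js, M) ↦ colFold N |budget| js M`. [cite: AroraBarak2009, §1.3] -/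
theorem colFold_codeFP :
    CodeFP (pairE (pairE natE budE) (pairE (rawE natE) matE)) matE (fun t => colFold t.1.1 t.1.2.length t.2.1 t.2.2) := by
  let cE := pairE (pairE natE budE) matE
  let tE := pairE cE (pairE natE matE)
  have pN : CodeFP tE natE (fun t => t.1.1.1) := (fst _ _).fst'.fst'
  have pB : CodeFP tE budE (fun t => t.1.1.2) := (fst _ _).fst'.snd'
  have pj : CodeFP tE natE (fun t => t.2.1) := (snd _ _).fst'
  have pM : CodeFP tE matE (fun t => t.2.2) := (snd _ _).snd'
  have hstep : CodeFP tE matE (fun t => ceuclid t.1.1.1 t.1.1.2.length t.2.1 t.2.2) :=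
    ceuclid_codeFP.comp (((pN.pair pj).pair pM).pair pB)
  have hinit : CodeFP cE matE (fun s => s.2) := snd _ _
  have hfold := foldl (σ := (ℕ × List Unit) × List (List ℕ)) (α := ℕ) (β := List (List ℕ))
    (eσ := cE) (eα := natE) (eβ := matE)
    (step := fun s j M => ceuclid s.1.1 s.1.2.length j M) (init := fun s => s.2) hstep hinit
    (X * (2 * (X * (2 * X + 2)) + 2)) (fun s l₁ l₂ => by
      obtain ⟨⟨N, bud⟩, M⟩ := s
      set W := (pairE cE (rawE natE) (((N, bud), M), l₁ ++ l₂)).length with hW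
      have hWN : (natE N).length ≤ W := by simp only [hW, cE, pairE_apply, length_boolPair]; omega
      have hM : (rawE (rawE natE) M).length ≤ W := by simp only [hW, cE, pairE_apply, length_boolPair]; omega
      have hsm := matSmall_colFold hWN bud.length l₁ (matSmall_of_length_le hM)
      change (rawE (rawE natE) (l₁.foldl (fun M j => ceuclid N bud.length j M) M)).length ≤ _
      rw [← colFold]
      have b := length_rawE_le_of_matSmall hsm
      simp only [eval_add, eval_mul, eval_ofNat, eval_X]
      exact b)
  exact (hfold.comp (((fst _ _).pair (snd _ _).snd').pair (snd _ _).fst')).congr fun _ => rfl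

/-- The length of the top row is invariant under `cstep`. [folklore] -/
theorem length_headD_cstep (N j : ℕ) (M : List (List ℕ)) : ((cstep N j M).headD []).length = (M.headD []).length := by
  cases M with
  | nil => rw [cstep_of_key_eq_zero (by simp)]
  | cons t M =>
    rcases cstep_cases (N := N) j (t :: M) with e | ⟨q, e⟩ | ⟨q, e⟩ <;> rw [e] <;> simp

/-- The length of the top row is invariant under `ceuclid`. [folklore] -/
theorem length_headD_ceuclid (N F j : ℕ) (M : List (List ℕ)) : ((ceuclid N F j M).headD []).length = (M.headD []).length := by
  induction F generalizing M with
  | zero => rfl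
  | succ F ih => rw [ceuclid, ih, length_headD_cstep]

/-- The length of the top row is invariant under `colFold`. [folklore] -/
theorem length_headD_colFold (N F : ℕ) (js : List ℕ) (M : List (List ℕ)) :
    ((colFold N F js M).headD []).length = (M.headD []).length := by
  induction js generalizing M with
  | nil => rfl
  | cons j js ih => rw [colFold, List.foldl_cons, ← colFold, ih, length_headD_ceuclid]

/-- Column indices beyond the top row are no-ops of the column fold. [folklore] -/
theorem colFold_of_le (N F : ℕ) (js : List ℕ) (M : List (List ℕ)) (h : ∀ j ∈ js, (M.headD []).length ≤ j) :
    colFold N F js M = M := by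
  induction js generalizing M with
  | nil => rfl
  | cons j js ih =>
    rw [colFold, List.foldl_cons, ← colFold, ceuclid_of_key_eq_zero F (getD_of_le (h j List.mem_cons_self))]
    exact ih M (fun j' hj' => h j' (List.mem_cons_of_mem j hj'))

/-- `colFold` over a concatenation. [folklore] -/
theorem colFold_append (N F : ℕ) (js js' : List ℕ) (M : List (List ℕ)) :
    colFold N F (js ++ js') M = colFold N F js' (colFold N F js M) := by
  rw [colFold, List.foldl_append]; rfl

/-- **The column phase only needs the columns inside the top row**:
`colPhase N F c M = colFold N F [1, …, min (c, |top|) - 1] M`. [folklore] -/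
theorem colPhase_eq_colFold_min (N F c : ℕ) (M : List (List ℕ)) :
    colPhase N F c M = colFold N F (List.range' 1 (min c (M.headD []).length - 1)) M := by
  rw [colPhase]
  set L := (M.headD []).length with hL
  by_cases hcL : c ≤ L
  · rw [min_eq_left hcL]
  · rw [not_le] at hcL
    rw [min_eq_right hcL.le]
    rcases Nat.eq_zero_or_pos L with hL0 | hLpos
    · rw [hL0]
      rw [colFold_of_le N F _ M (fun j _ => by rw [← hL, hL0]; exact Nat.zero_le j)]
      rfl
    · have hsplit : List.range' 1 (c - 1) = List.range' 1 (L - 1) ++ List.range' L (c - 1 - (L - 1)) := by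
        have := @List.range'_append 1 (L - 1) (c - 1 - (L - 1)) 1
        rw [show 1 + 1 * (L - 1) = L by omega, show L - 1 + (c - 1 - (L - 1)) = c - 1 by omega] at this
        exact this.symm
      rw [hsplit, colFold_append, colFold_of_le]
      intro j hj
      rw [List.mem_range'_1] at hj
      rw [length_headD_colFold, ← hL]
      exact hj.1

/-- **The column phase on codes**: `((N, budget), c, M) ↦ colPhase N |budget| c M`, through the
columns `1, …, min (c, |top|) - 1`. [cite: AroraBarak2009, §1.3] -/
theorem colPhase_codeFP :
    CodeFP (pairE (pairE natE budE) (pairE natE matE)) matE (fun t => colPhase t.1.1 t.1.2.length t.2.1 t.2.2) := by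
  let tE := pairE (pairE natE budE) (pairE natE matE)
  have pc : CodeFP tE natE (fun t => t.2.1) := (snd _ _).fst'
  have pM : CodeFP tE matE (fun t => t.2.2) := (snd _ _).snd'
  -- `min c |top|` in unary (the top row as the budget), then `min c |top| - 1` in unary
  have hL : CodeFP tE unE (fun t => (t.2.2.headD []).length) := (ulength natE).comp ((rawHeadD (rawE natE) (d := []) rfl).comp pM)
  have hm : CodeFP tE unE (fun t => min t.2.1 (t.2.2.headD []).length) := unOfNatMin.comp (hL.pair pc)
  have hm1 : CodeFP tE unE (fun t => min t.2.1 (t.2.2.headD []).length - 1) :=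
    (unOfNatMin.comp (hm.pair (natSub.comp ((natOfUn.comp hm).pair (const _ 1))))).congr fun t => by
      simp only [id]; omega
  -- the column list `[1, …, m - 1]`
  have hjs : CodeFP tE (rawE natE) (fun t => List.range' 1 (min t.2.1 (t.2.2.headD []).length - 1)) :=
    ((map₀ (natAdd.comp ((const _ 1).pair (CodeFP.id natE)))).comp (urange.comp hm1)).congr fun t => by
      rw [List.range'_eq_map_range]; rfl
  exact ((colFold_codeFP.comp ((fst _ _).pair (hjs.pair pM))).congr fun t => (colPhase_eq_colFold_min _ _ _ _).symm)

/-- The column phase keeps a small row list small. [folklore] -/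
theorem matSmall_colPhase {W N : ℕ} (hN : (natE N).length ≤ W) (F c : ℕ) {M : List (List ℕ)} (h : MatSmall W M) :
    MatSmall W (colPhase N F c M) := matSmall_colFold hN F _ h

/-! ### Rounds -/

/-- A round keeps a small row list small. [folklore] -/
theorem matSmall_round {W N : ℕ} (hN : (natE N).length ≤ W) (F c : ℕ) {M : List (List ℕ)} (h : MatSmall W M) :
    MatSmall W (round N F c M) := matSmall_colPhase hN F c (matSmall_rowPhase hN F h)

/-- The rounds keep a small row list small. [folklore] -/
theorem matSmall_rounds {W N : ℕ} (hN : (natE N).length ≤ W) (F c R : ℕ) {M : List (List ℕ)} (h : MatSmall W M) :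
    MatSmall W (rounds N F c R M) := by
  induction R generalizing M with
  | zero => exact h
  | succ R ih => rw [rounds]; exact ih (matSmall_round hN F c h)

/-- **One round on codes**: `((N, budget), c, M) ↦ round N |budget| c M`. [cite: AroraBarak2009, §1.3] -/
theorem round_codeFP :
    CodeFP (pairE (pairE natE budE) (pairE natE matE)) matE (fun t => round t.1.1 t.1.2.length t.2.1 t.2.2) :=
  (colPhase_codeFP.comp ((fst _ _).pair ((snd _ _).fst'.pair (rowPhase_codeFP.comp ((fst _ _).pair (snd _ _).snd'))))).congr
    fun _ => rfl

/-- The rounds as a left fold over a budget. [folklore] -/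
theorem rounds_eq_foldl (N F c : ℕ) (l : List Unit) (M : List (List ℕ)) :
    rounds N F c l.length M = l.foldl (fun M _ => round N F c M) M := by
  induction l generalizing M with
  | nil => rfl
  | cons u l ih => rw [List.length_cons, rounds, List.foldl_cons, ih]

/-- **The rounds on codes**: `(((N, budgetF, c), M), budgetR) ↦ rounds N |budgetF| c |budgetR| M`.
[cite: AroraBarak2009, §1.3 (polynomially bounded loops)] -/
theorem rounds_codeFP :
    CodeFP (pairE (pairE (pairE natE (pairE budE natE)) matE) budE) matE
      (fun p => rounds p.1.1.1 p.1.1.2.1.length p.1.1.2.2 p.2.length p.1.2) := by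
  let cE := pairE (pairE natE (pairE budE natE)) matE
  let tE := pairE cE (pairE unitE matE)
  have pN : CodeFP tE natE (fun t => t.1.1.1) := (fst _ _).fst'.fst'
  have pB : CodeFP tE budE (fun t => t.1.1.2.1) := (fst _ _).fst'.snd'.fst'
  have pc : CodeFP tE natE (fun t => t.1.1.2.2) := (fst _ _).fst'.snd'.snd'
  have pM : CodeFP tE matE (fun t => t.2.2) := (snd _ _).snd'
  have hstep : CodeFP tE matE (fun t => round t.1.1.1 t.1.1.2.1.length t.1.1.2.2 t.2.2) :=
    round_codeFP.comp ((pN.pair pB).pair (pc.pair pM))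
  have hinit : CodeFP cE matE (fun s => s.2) := snd _ _
  have hfold := foldl (σ := (ℕ × (List Unit × ℕ)) × List (List ℕ)) (α := Unit) (β := List (List ℕ))
    (eσ := cE) (eα := unitE) (eβ := matE)
    (step := fun s _ M => round s.1.1 s.1.2.1.length s.1.2.2 M) (init := fun s => s.2) hstep hinit
    (X * (2 * (X * (2 * X + 2)) + 2)) (fun s l₁ l₂ => by
      obtain ⟨⟨N, bud, c⟩, M⟩ := s
      set W := (pairE cE budE (((N, bud, c), M), l₁ ++ l₂)).length with hW
      have hWN : (natE N).length ≤ W := by simp only [hW, cE, pairE_apply, length_boolPair]; omega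
      have hM : (rawE (rawE natE) M).length ≤ W := by simp only [hW, cE, pairE_apply, length_boolPair]; omega
      have hsm := matSmall_rounds hWN bud.length c l₁.length (matSmall_of_length_le hM)
      change (rawE (rawE natE) (l₁.foldl (fun M _ => round N bud.length c M) M)).length ≤ _
      rw [← rounds_eq_foldl]
      have b := length_rawE_le_of_matSmall hsm
      simp only [eval_add, eval_mul, eval_ofNat, eval_X]
      exact b)
  exact hfold.congr fun p => (rounds_eq_foldl p.1.1.1 p.1.1.2.1.length p.1.1.2.2 p.2 p.1.2).symm

end ModDiagFP

end Literature.Computability.Complexity
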